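import Summits.KontsevichZagierPeriods.KontsevichZagierPeriods.Theorems.HurwitzMicroSectorsHurwitzSectorComplementStubLadderDescentSteps

/-!
# `HurwitzSectorComplement` (stmt-KontsevichZagierPeriods-14341), line `chebyshev-level-deformation`,
# stub S3 `stub_ladderDescent` — part 4: the U-step and the parity induction (the stub itself)

Def-free. With the engine S1 (`hT`, `hU`), the arcs S2a (`hA1`) and the bottom cell S2b (`hBot`) as
hypotheses, the three ladder families

* `U n` : `[(0,1)^n × Δ_{k+1}(tan(πj/L)), (∏ 2/(1+y_i²)) · U(y₀, p)] ∈ ℚ·𝔭`,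
* `T n` : `[(0,1)^n × Δ_{k+1}(tan(πj/L)), (∏ 2/(1+y_i²)) · T(y₀, p)] ∈ ℚ·𝔭`,
* `Z n` : `[(0,1)^n, 1/(1−p)] ∈ ℚ·𝔭`

satisfy `U 1` (bottom cell, `base_of_bottomCell`), `U (n+1) → Z (n+2)` (`step_zeta`, the ladder at
`v₀ = 1 = tan(π/4)`), `Z (n+2) → U (n+1) → T (n+2)` (`step_T`) and `T (n+1) → U (n+2)` (`ladderDescent_stepU`,
this file: one U-step of the engine — a registered sub-goal). Bernoulli parity: `Nat.twoStepInduction` proves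
`(Odd n → U n) ∧ (Even n → 2 ≤ n → Z n ∧ T n)` for every `n`; the four descents of the stub are
`conc_T` (even `w`), `ladder_U0` + `T (w−1)` (odd `w ≥ 3`), `Z w` and `conc_inv` (even `w`).

References: M. Kontsevich, D. Zagier, *Periods* (2001), §1.2.
-/

noncomputable section

open Set MeasureTheory
open scoped BigOperators
open Literature.NumberTheory.Transcendental

namespace Summit.KontsevichZagierPeriods.Theorems.HurwitzMicroSectorsHurwitzSectorComplement

/-! ## The U-step (registered sub-goal `ladderDescent_stepU`) -/

/-- **Registered sub-goal `ladderDescent_stepU`** (line `chebyshev-level-deformation`, stub S3): given the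
U-step of the engine S1, the U-objects descend to the T-objects one box dimension lower,
`𝔘_{m+2,k+1} ∈ ℚ·𝔭 ⇐ (∀ k, 𝔗_{m+1,k+1} ∈ ℚ·𝔭)`: one U-step on the chain cells
(`LadderDescent.ladder_U`: `[(0,1)^{m+2} × Δ_{k+1}, W·U(y₀,p)] ≡ [(0,1)^{m+1} × Δ_{k+2}, W·ω(y₀)·T(y₀,p′)]`)
and invariance of `ℚ·𝔭` under equivalence. [cite: KontsevichZagier2001, §1.2] -/
theorem ladderDescent_stepU :
    (∀ (m k : ℕ) (D : Set (Fin k → ℝ)) (W lam : (Fin k → ℝ) → ℝ) (M Λ : ℝ),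
      Literature.ModelTheory.ExponentialFields.IsSemialgebraic ℚ D → Bornology.IsBounded D →
      IsSemialgebraicFunOn ℚ D W → IsSemialgebraicFunOn ℚ D lam →
      (∀ y ∈ D, |W y| ≤ M) → (∀ y ∈ D, 0 < lam y ∧ lam y ≤ Λ) →
      ∀ (r : KZ.IntegralRep (m + 2 + k)),
        r.domain = {z | (∀ i : Fin (m + 2), z (Fin.castAdd k i) ∈ Set.Ioo (0:ℝ) 1) ∧
          (fun j : Fin k => z (Fin.natAdd (m + 2) j)) ∈ D} →
        Set.EqOn r.integrand (fun z => W (fun j : Fin k => z (Fin.natAdd (m + 2) j)) *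
          (2 * lam (fun j : Fin k => z (Fin.natAdd (m + 2) j)) /
            ((1 - ∏ i : Fin (m + 2), z (Fin.castAdd k i)) ^ 2 +
              (lam (fun j : Fin k => z (Fin.natAdd (m + 2) j))) ^ 2 *
                (1 + ∏ i : Fin (m + 2), z (Fin.castAdd k i)) ^ 2))) r.domain →
        ∃ (r₂ : KZ.IntegralRep (m + 1 + (k + 1))),
          r₂.domain = {z | (∀ i : Fin (m + 1), z (Fin.castAdd (k + 1) i) ∈ Set.Ioo (0:ℝ) 1) ∧
            (fun j : Fin k => z (Fin.natAdd (m + 1) j.succ)) ∈ D ∧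
            0 < z (Fin.natAdd (m + 1) 0) ∧
            z (Fin.natAdd (m + 1) 0) < lam ((fun j : Fin k => z (Fin.natAdd (m + 1) j.succ)))} ∧
          (r₂.integrand = fun z => W ((fun j : Fin k => z (Fin.natAdd (m + 1) j.succ))) *
            (2 / (1 + (z (Fin.natAdd (m + 1) 0)) ^ 2)) *
            (((1 - ∏ i : Fin (m + 1), z (Fin.castAdd (k + 1) i)) -
                (z (Fin.natAdd (m + 1) 0)) ^ 2 * (1 + ∏ i : Fin (m + 1), z (Fin.castAdd (k + 1) i))) /
              ((1 - ∏ i : Fin (m + 1), z (Fin.castAdd (k + 1) i)) ^ 2 +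
                (z (Fin.natAdd (m + 1) 0)) ^ 2 * (1 + ∏ i : Fin (m + 1), z (Fin.castAdd (k + 1) i)) ^ 2))) ∧
          KZ.of r - KZ.of r₂ ∈ KZ.relations) →
    ∀ (m : ℕ), (∀ (k j L : ℕ), 0 < j → 2 * j < L → ∀ (r : KZ.IntegralRep (m + 1 + (k + 1))),
      r.domain = {z | (∀ i : Fin (m + 1), z (Fin.castAdd (k + 1) i) ∈ Set.Ioo (0:ℝ) 1) ∧
        (∀ i : Fin (k + 1), 0 < z (Fin.natAdd (m + 1) i) ∧ z (Fin.natAdd (m + 1) i) < Real.tan (Real.pi * j / L)) ∧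
        (∀ i i' : Fin (k + 1), i < i' → z (Fin.natAdd (m + 1) i) < z (Fin.natAdd (m + 1) i'))} →
      Set.EqOn r.integrand (fun z => (∏ i : Fin (k + 1), 2 / (1 + (z (Fin.natAdd (m + 1) i)) ^ 2)) *
        (((1 - ∏ i : Fin (m + 1), z (Fin.castAdd (k + 1) i)) - (z (Fin.natAdd (m + 1) 0)) ^ 2 * (1 + ∏ i : Fin (m + 1), z (Fin.castAdd (k + 1) i))) /
          ((1 - ∏ i : Fin (m + 1), z (Fin.castAdd (k + 1) i)) ^ 2 + (z (Fin.natAdd (m + 1) 0)) ^ 2 * (1 + ∏ i : Fin (m + 1), z (Fin.castAdd (k + 1) i)) ^ 2))) r.domain →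
      ∃ q : ℚ, ∀ (s : KZ.IntegralRep (m + 1 + (k + 1))), s.domain = {x | ∀ i, x i ∈ Set.Ioo (0:ℝ) 1} →
        Set.EqOn s.integrand (fun x => (q : ℝ) * ∏ i, 2 / (1 + (x i) ^ 2)) s.domain →
        KZ.Equivalent r s) →
    ∀ (k j L : ℕ), 0 < j → 2 * j < L → ∀ (r : KZ.IntegralRep (m + 2 + (k + 1))),
      r.domain = {z | (∀ i : Fin (m + 2), z (Fin.castAdd (k + 1) i) ∈ Set.Ioo (0:ℝ) 1) ∧
        (∀ i : Fin (k + 1), 0 < z (Fin.natAdd (m + 2) i) ∧ z (Fin.natAdd (m + 2) i) < Real.tan (Real.pi * j / L)) ∧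
        (∀ i i' : Fin (k + 1), i < i' → z (Fin.natAdd (m + 2) i) < z (Fin.natAdd (m + 2) i'))} →
      Set.EqOn r.integrand (fun z => (∏ i : Fin (k + 1), 2 / (1 + (z (Fin.natAdd (m + 2) i)) ^ 2)) *
        (2 * z (Fin.natAdd (m + 2) 0) /
          ((1 - ∏ i : Fin (m + 2), z (Fin.castAdd (k + 1) i)) ^ 2 + (z (Fin.natAdd (m + 2) 0)) ^ 2 * (1 + ∏ i : Fin (m + 2), z (Fin.castAdd (k + 1) i)) ^ 2))) r.domain →
      ∃ q : ℚ, ∀ (s : KZ.IntegralRep (m + 2 + (k + 1))), s.domain = {x | ∀ i, x i ∈ Set.Ioo (0:ℝ) 1} →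
        Set.EqOn s.integrand (fun x => (q : ℝ) * ∏ i, 2 / (1 + (x i) ^ 2)) s.domain →
        KZ.Equivalent r s := by
  intro hU m hTT k j L hj hjL r hdom hint
  obtain ⟨r₂, h2d, h2i, hrel⟩ := LadderDescent.ladder_U hU m k j L hj hjL r hdom hint
  exact LadderDescent.inQP_of_equivalent hrel
    (LadderDescent.inQP_cast (by omega) (hTT (k + 1) j L hj hjL r₂ h2d h2i))


/-! ## The stub -/

/-- **S3, ladder descent.** From S1, S2a, S2b: for cyclotomic half-angles `v₀ = tan(πj/L)`
(`0 < j`, `2j < L`) the Chebyshev box representations `[(0,1)^w, T(v₀, x₁⋯x_w)]` (`w ≥ 2` even) and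
`[(0,1)^w, U(v₀, x₁⋯x_w)]` (`w ≥ 3` odd), and the level-1/2 representations `[(0,1)^w, 1/(1−t)]`,
`[(0,1)^w, 1/(1+t)]` (`w ≥ 2` even), are KZ-equivalent to RATIONAL multiples of
`𝔭_w = [(0,1)^w, ∏ 2/(1+x_i²)]` (value `(π/2)^w`). Bernoulli-parity induction down the ladder
(`Nat.twoStepInduction` on `(Odd n → U n) ∧ (Even n → 2 ≤ n → Z n ∧ T n)`): `U 1` is the bottom cell
S2b, `U (n+1) → Z (n+2)` is the ladder at `v₀ = 1` with the level-4 dilation algebra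
(`LadderDescent.step_zeta`), `Z (n+2) → U (n+1) → T (n+2)` peels the Fubini product
`[(0,1)^{n+2}, 1/(1−p)] × [Δ, ∏ω]` (`LadderDescent.step_T`, S2a), `T (n+1) → U (n+2)` is one U-step
(`LadderDescent.step_U`); the four descents are `conc_T`, `ladder_U0`, `Z`, `conc_inv`
(`[1/(1+t)] ≡ (1 − 2^{1−w})[1/(1−t)]`). [cite: KontsevichZagier2001, §1.2] -/
theorem stub_ladderDescent :
    ((∀ (m k : ℕ) (D : Set (Fin k → ℝ)) (W lam : (Fin k → ℝ) → ℝ) (M Λ : ℝ),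
      Literature.ModelTheory.ExponentialFields.IsSemialgebraic ℚ D → Bornology.IsBounded D →
      IsSemialgebraicFunOn ℚ D W → IsSemialgebraicFunOn ℚ D lam →
      (∀ y ∈ D, |W y| ≤ M) → (∀ y ∈ D, 0 < lam y ∧ lam y ≤ Λ) →
      ∀ (r : KZ.IntegralRep (m + 2 + k)),
        r.domain = {z | (∀ i : Fin (m + 2), z (Fin.castAdd k i) ∈ Set.Ioo (0:ℝ) 1) ∧
          (fun j : Fin k => z (Fin.natAdd (m + 2) j)) ∈ D} →
        Set.EqOn r.integrand (fun z => W (fun j : Fin k => z (Fin.natAdd (m + 2) j)) *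
          (((1 - ∏ i : Fin (m + 2), z (Fin.castAdd k i)) -
              (lam (fun j : Fin k => z (Fin.natAdd (m + 2) j))) ^ 2 *
                (1 + ∏ i : Fin (m + 2), z (Fin.castAdd k i))) /
            ((1 - ∏ i : Fin (m + 2), z (Fin.castAdd k i)) ^ 2 +
              (lam (fun j : Fin k => z (Fin.natAdd (m + 2) j))) ^ 2 *
                (1 + ∏ i : Fin (m + 2), z (Fin.castAdd k i)) ^ 2))) r.domain →
        ∃ (r₁ : KZ.IntegralRep (m + 2 + k)) (r₂ : KZ.IntegralRep (m + 1 + (k + 1))),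
          r₁.domain = r.domain ∧
          (r₁.integrand = fun z => W (fun j : Fin k => z (Fin.natAdd (m + 2) j)) /
            (1 - ∏ i : Fin (m + 2), z (Fin.castAdd k i))) ∧
          r₂.domain = {z | (∀ i : Fin (m + 1), z (Fin.castAdd (k + 1) i) ∈ Set.Ioo (0:ℝ) 1) ∧
            (fun j : Fin k => z (Fin.natAdd (m + 1) j.succ)) ∈ D ∧
            0 < z (Fin.natAdd (m + 1) 0) ∧
            z (Fin.natAdd (m + 1) 0) < lam ((fun j : Fin k => z (Fin.natAdd (m + 1) j.succ)))} ∧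
          (r₂.integrand = fun z => W ((fun j : Fin k => z (Fin.natAdd (m + 1) j.succ))) *
            (2 / (1 + (z (Fin.natAdd (m + 1) 0)) ^ 2)) *
            (2 * z (Fin.natAdd (m + 1) 0) /
              ((1 - ∏ i : Fin (m + 1), z (Fin.castAdd (k + 1) i)) ^ 2 +
                (z (Fin.natAdd (m + 1) 0)) ^ 2 * (1 + ∏ i : Fin (m + 1), z (Fin.castAdd (k + 1) i)) ^ 2))) ∧
          KZ.of r - KZ.of r₁ + KZ.of r₂ ∈ KZ.relations) ∧
    (∀ (m k : ℕ) (D : Set (Fin k → ℝ)) (W lam : (Fin k → ℝ) → ℝ) (M Λ : ℝ),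
      Literature.ModelTheory.ExponentialFields.IsSemialgebraic ℚ D → Bornology.IsBounded D →
      IsSemialgebraicFunOn ℚ D W → IsSemialgebraicFunOn ℚ D lam →
      (∀ y ∈ D, |W y| ≤ M) → (∀ y ∈ D, 0 < lam y ∧ lam y ≤ Λ) →
      ∀ (r : KZ.IntegralRep (m + 2 + k)),
        r.domain = {z | (∀ i : Fin (m + 2), z (Fin.castAdd k i) ∈ Set.Ioo (0:ℝ) 1) ∧
          (fun j : Fin k => z (Fin.natAdd (m + 2) j)) ∈ D} →
        Set.EqOn r.integrand (fun z => W (fun j : Fin k => z (Fin.natAdd (m + 2) j)) *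
          (2 * lam (fun j : Fin k => z (Fin.natAdd (m + 2) j)) /
            ((1 - ∏ i : Fin (m + 2), z (Fin.castAdd k i)) ^ 2 +
              (lam (fun j : Fin k => z (Fin.natAdd (m + 2) j))) ^ 2 *
                (1 + ∏ i : Fin (m + 2), z (Fin.castAdd k i)) ^ 2))) r.domain →
        ∃ (r₂ : KZ.IntegralRep (m + 1 + (k + 1))),
          r₂.domain = {z | (∀ i : Fin (m + 1), z (Fin.castAdd (k + 1) i) ∈ Set.Ioo (0:ℝ) 1) ∧
            (fun j : Fin k => z (Fin.natAdd (m + 1) j.succ)) ∈ D ∧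
            0 < z (Fin.natAdd (m + 1) 0) ∧
            z (Fin.natAdd (m + 1) 0) < lam ((fun j : Fin k => z (Fin.natAdd (m + 1) j.succ)))} ∧
          (r₂.integrand = fun z => W ((fun j : Fin k => z (Fin.natAdd (m + 1) j.succ))) *
            (2 / (1 + (z (Fin.natAdd (m + 1) 0)) ^ 2)) *
            (((1 - ∏ i : Fin (m + 1), z (Fin.castAdd (k + 1) i)) -
                (z (Fin.natAdd (m + 1) 0)) ^ 2 * (1 + ∏ i : Fin (m + 1), z (Fin.castAdd (k + 1) i))) /
              ((1 - ∏ i : Fin (m + 1), z (Fin.castAdd (k + 1) i)) ^ 2 +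
                (z (Fin.natAdd (m + 1) 0)) ^ 2 * (1 + ∏ i : Fin (m + 1), z (Fin.castAdd (k + 1) i)) ^ 2))) ∧
          KZ.of r - KZ.of r₂ ∈ KZ.relations)) →
    ((∀ (a j₀ j₁ L : ℕ), j₀ < j₁ → 2 * j₁ < L → ∀ (r : KZ.IntegralRep a),
      r.domain = {y | (∀ i, Real.tan (Real.pi * j₀ / L) < y i ∧ y i < Real.tan (Real.pi * j₁ / L)) ∧
        (∀ i i' : Fin a, i < i' → y i < y i')} →
      Set.EqOn r.integrand (fun y => ∏ i, 2 / (1 + (y i) ^ 2)) r.domain →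
      ∃ q : ℚ, ∀ (s : KZ.IntegralRep a), s.domain = {x | ∀ i, x i ∈ Set.Ioo (0:ℝ) 1} →
        Set.EqOn s.integrand (fun x => (q : ℝ) * ∏ i, 2 / (1 + (x i) ^ 2)) s.domain →
        KZ.Equivalent r s) ∧
    (∀ (r : KZ.IntegralRep 1), r.domain = {z | 0 < z 0} →
      Set.EqOn r.integrand (fun z => 1 / (1 + (z 0) ^ 2)) r.domain →
      ∀ (s : KZ.IntegralRep 1), s.domain = {x | ∀ i, x i ∈ Set.Ioo (0:ℝ) 1} →
        Set.EqOn s.integrand (fun x => ∏ i, 2 / (1 + (x i) ^ 2)) s.domain →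
        KZ.Equivalent r s)) →
    (∀ (k j L : ℕ), 0 < j → 2 * j < L → ∀ (r : KZ.IntegralRep (1 + (k + 1))),
      r.domain = {z | z (Fin.castAdd (k + 1) 0) ∈ Set.Ioo (0:ℝ) 1 ∧
        (∀ i : Fin (k + 1), 0 < z (Fin.natAdd 1 i) ∧ z (Fin.natAdd 1 i) < Real.tan (Real.pi * j / L)) ∧
        (∀ i i' : Fin (k + 1), i < i' → z (Fin.natAdd 1 i) < z (Fin.natAdd 1 i'))} →
      Set.EqOn r.integrand (fun z => (∏ i : Fin (k + 1), 2 / (1 + (z (Fin.natAdd 1 i)) ^ 2)) *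
        (2 * z (Fin.natAdd 1 0) /
          ((1 - z (Fin.castAdd (k + 1) 0)) ^ 2 +
            (z (Fin.natAdd 1 0)) ^ 2 * (1 + z (Fin.castAdd (k + 1) 0)) ^ 2))) r.domain →
      ∃ q : ℚ, ∀ (s : KZ.IntegralRep (1 + (k + 1))), s.domain = {x | ∀ i, x i ∈ Set.Ioo (0:ℝ) 1} →
        Set.EqOn s.integrand (fun x => (q : ℝ) * ∏ i, 2 / (1 + (x i) ^ 2)) s.domain →
        KZ.Equivalent r s) →
    (∀ (w j L : ℕ), 2 ≤ w → Even w → 0 < j → 2 * j < L → ∀ (r : KZ.IntegralRep w),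
      r.domain = {x | ∀ i, x i ∈ Set.Ioo (0:ℝ) 1} →
      Set.EqOn r.integrand (fun x =>
        ((1 - ∏ i, x i) - (Real.tan (Real.pi * j / L)) ^ 2 * (1 + ∏ i, x i)) /
          ((1 - ∏ i, x i) ^ 2 + (Real.tan (Real.pi * j / L)) ^ 2 * (1 + ∏ i, x i) ^ 2)) r.domain →
      ∃ q : ℚ, ∀ (s : KZ.IntegralRep w), s.domain = {x | ∀ i, x i ∈ Set.Ioo (0:ℝ) 1} →
        Set.EqOn s.integrand (fun x => (q : ℝ) * ∏ i, 2 / (1 + (x i) ^ 2)) s.domain →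
        KZ.Equivalent r s) ∧
    (∀ (w j L : ℕ), 3 ≤ w → Odd w → 0 < j → 2 * j < L → ∀ (r : KZ.IntegralRep w),
      r.domain = {x | ∀ i, x i ∈ Set.Ioo (0:ℝ) 1} →
      Set.EqOn r.integrand (fun x =>
        2 * Real.tan (Real.pi * j / L) /
          ((1 - ∏ i, x i) ^ 2 + (Real.tan (Real.pi * j / L)) ^ 2 * (1 + ∏ i, x i) ^ 2)) r.domain →
      ∃ q : ℚ, ∀ (s : KZ.IntegralRep w), s.domain = {x | ∀ i, x i ∈ Set.Ioo (0:ℝ) 1} →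
        Set.EqOn s.integrand (fun x => (q : ℝ) * ∏ i, 2 / (1 + (x i) ^ 2)) s.domain →
        KZ.Equivalent r s) ∧
    (∀ (w : ℕ), 2 ≤ w → Even w → ∀ (r : KZ.IntegralRep w),
      r.domain = {x | ∀ i, x i ∈ Set.Ioo (0:ℝ) 1} →
      Set.EqOn r.integrand (fun x => 1 / (1 - ∏ i, x i)) r.domain →
      ∃ q : ℚ, ∀ (s : KZ.IntegralRep w), s.domain = {x | ∀ i, x i ∈ Set.Ioo (0:ℝ) 1} →
        Set.EqOn s.integrand (fun x => (q : ℝ) * ∏ i, 2 / (1 + (x i) ^ 2)) s.domain →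
        KZ.Equivalent r s) ∧
    (∀ (w : ℕ), 2 ≤ w → Even w → ∀ (r : KZ.IntegralRep w),
      r.domain = {x | ∀ i, x i ∈ Set.Ioo (0:ℝ) 1} →
      Set.EqOn r.integrand (fun x => 1 / (1 + ∏ i, x i)) r.domain →
      ∃ q : ℚ, ∀ (s : KZ.IntegralRep w), s.domain = {x | ∀ i, x i ∈ Set.Ioo (0:ℝ) 1} →
        Set.EqOn s.integrand (fun x => (q : ℝ) * ∏ i, 2 / (1 + (x i) ^ 2)) s.domain →
        KZ.Equivalent r s) := by
  rintro ⟨hT, hU⟩ ⟨hA1, -⟩ hBot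
  -- the bottom of the ladder: `U 1`
  have hU1 := LadderDescent.base_of_bottomCell hBot
  -- Bernoulli parity induction: `(Odd n → U n) ∧ (Even n → 2 ≤ n → Z n ∧ T n)`
  have main : ∀ n : ℕ,
      (Odd n → ∀ (k j L : ℕ), 0 < j → 2 * j < L → ∀ (r : KZ.IntegralRep (n + (k + 1))),
        r.domain = {z | (∀ i : Fin (n), z (Fin.castAdd (k + 1) i) ∈ Set.Ioo (0:ℝ) 1) ∧
          (∀ i : Fin (k + 1), 0 < z (Fin.natAdd (n) i) ∧ z (Fin.natAdd (n) i) < Real.tan (Real.pi * j / L)) ∧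
          (∀ i i' : Fin (k + 1), i < i' → z (Fin.natAdd (n) i) < z (Fin.natAdd (n) i'))} →
        Set.EqOn r.integrand (fun z => (∏ i : Fin (k + 1), 2 / (1 + (z (Fin.natAdd (n) i)) ^ 2)) *
          (2 * z (Fin.natAdd (n) 0) /
            ((1 - ∏ i : Fin (n), z (Fin.castAdd (k + 1) i)) ^ 2 + (z (Fin.natAdd (n) 0)) ^ 2 * (1 + ∏ i : Fin (n), z (Fin.castAdd (k + 1) i)) ^ 2))) r.domain →
        ∃ q : ℚ, ∀ (s : KZ.IntegralRep (n + (k + 1))), s.domain = {x | ∀ i, x i ∈ Set.Ioo (0:ℝ) 1} →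
          Set.EqOn s.integrand (fun x => (q : ℝ) * ∏ i, 2 / (1 + (x i) ^ 2)) s.domain →
          KZ.Equivalent r s) ∧
      (Even n → 2 ≤ n →
        (∀ (r : KZ.IntegralRep (n)), r.domain = {x | ∀ i, x i ∈ Set.Ioo (0:ℝ) 1} →
          Set.EqOn r.integrand (fun x => 1 / (1 - ∏ i, x i)) r.domain →
          ∃ q : ℚ, ∀ (s : KZ.IntegralRep (n)), s.domain = {x | ∀ i, x i ∈ Set.Ioo (0:ℝ) 1} →
            Set.EqOn s.integrand (fun x => (q : ℝ) * ∏ i, 2 / (1 + (x i) ^ 2)) s.domain →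
            KZ.Equivalent r s) ∧
        (∀ (k j L : ℕ), 0 < j → 2 * j < L → ∀ (r : KZ.IntegralRep (n + (k + 1))),
          r.domain = {z | (∀ i : Fin (n), z (Fin.castAdd (k + 1) i) ∈ Set.Ioo (0:ℝ) 1) ∧
            (∀ i : Fin (k + 1), 0 < z (Fin.natAdd (n) i) ∧ z (Fin.natAdd (n) i) < Real.tan (Real.pi * j / L)) ∧
            (∀ i i' : Fin (k + 1), i < i' → z (Fin.natAdd (n) i) < z (Fin.natAdd (n) i'))} →
          Set.EqOn r.integrand (fun z => (∏ i : Fin (k + 1), 2 / (1 + (z (Fin.natAdd (n) i)) ^ 2)) *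
            (((1 - ∏ i : Fin (n), z (Fin.castAdd (k + 1) i)) - (z (Fin.natAdd (n) 0)) ^ 2 * (1 + ∏ i : Fin (n), z (Fin.castAdd (k + 1) i))) /
              ((1 - ∏ i : Fin (n), z (Fin.castAdd (k + 1) i)) ^ 2 + (z (Fin.natAdd (n) 0)) ^ 2 * (1 + ∏ i : Fin (n), z (Fin.castAdd (k + 1) i)) ^ 2))) r.domain →
          ∃ q : ℚ, ∀ (s : KZ.IntegralRep (n + (k + 1))), s.domain = {x | ∀ i, x i ∈ Set.Ioo (0:ℝ) 1} →
            Set.EqOn s.integrand (fun x => (q : ℝ) * ∏ i, 2 / (1 + (x i) ^ 2)) s.domain →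
            KZ.Equivalent r s)) := by
    intro n
    induction n using Nat.twoStepInduction with
    | zero =>
      exact ⟨fun h => absurd (Nat.odd_iff.mp h) (by decide), fun _ h => absurd h (by decide)⟩
    | one =>
      exact ⟨fun _ => hU1, fun h => absurd (Nat.even_iff.mp h) (by decide)⟩
    | more n _ ih =>
      refine ⟨fun hodd => ?_, fun hev _ => ?_⟩
      · -- `U (n+2) ⇐ T (n+1)`, `n + 1` even and `≥ 2`
        have hodd' := Nat.odd_iff.mp hodd
        have hev : Even (n + 1) := Nat.even_iff.mpr (by omega)
        exact ladderDescent_stepU hU n (ih.2 hev (by omega)).2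
      · -- `Z (n+2) ⇐ U (n+1)` and `T (n+2) ⇐ Z (n+2), U (n+1)`, `n + 1` odd
        have hev' := Nat.even_iff.mp hev
        have hodd : Odd (n + 1) := Nat.odd_iff.mpr (by omega)
        have hZ := LadderDescent.step_zeta hT n (ih.1 hodd)
        exact ⟨hZ, LadderDescent.step_T hT hA1 n hZ (ih.1 hodd)⟩
  refine ⟨?_, ?_, fun w hw hev => ((main w).2 hev hw).1, fun w hw hev =>
    LadderDescent.conc_inv w hw ((main w).2 hev hw).1⟩
  · -- (C1) the T-boxes, `w` even
    intro w j L hw hev hj hjL r hdom hint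
    obtain ⟨N, rfl⟩ : ∃ N, w = N + 2 := ⟨w - 2, by omega⟩
    have hodd : Odd (N + 1) := Nat.odd_iff.mpr (by have := Nat.even_iff.mp hev; omega)
    exact LadderDescent.conc_T hT N ((main (N + 2)).2 hev hw).1 ((main (N + 1)).1 hodd)
      j L hj hjL r hdom hint
  · -- (C2) the U-boxes, `w` odd `≥ 3`: one U-step to `T (w−1)`
    intro w j L hw hodd hj hjL r hdom hint
    obtain ⟨N, rfl⟩ : ∃ N, w = N + 2 := ⟨w - 2, by omega⟩
    have hev : Even (N + 1) := Nat.even_iff.mpr (by have := Nat.odd_iff.mp hodd; omega)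
    obtain ⟨r₂, h2d, h2i, hrel⟩ := LadderDescent.ladder_U0 hU N j L hj hjL r hdom hint
    exact LadderDescent.inQP_of_equivalent hrel (LadderDescent.inQP_cast (by omega)
      (((main (N + 1)).2 hev (by omega)).2 0 j L hj hjL r₂ h2d h2i))

end Summit.KontsevichZagierPeriods.Theorems.HurwitzMicroSectorsHurwitzSectorComplement

end
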